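import Summits.ResolutionOfSingularities.ResolutionOfSingularities.Theorems.HilbertSamuelEliminationSigmaMaxModificationsCorridor3SigmaSurfaceBadnessCureLists
import Literature.AlgebraicGeometry.Resolution.SncStrata
import HarnessLib

/-!
# [OURS · L1 W4.2] σ-LAYER PHASE B′ — `Corridor3SigmaSurfaceBadnessCureDrop`: THE CROSSING PART OF `M` DOES NOT INCREASE AT A CURE-CURVE STEP ON AN SNC
# CONFIGURATION OF A SURFACE, HENCE **`M` STRICTLY DROPS: `badness (cureAlong Γs ζ) < badness Γs`** for a BAD component `cl{ζ}` (`S_ζ ≥ 2`)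
# (res-L1-w42-stub-1 DESIGN CHECK 2 (a)(b) ON THE CARRIER: «cure along any bad `c` never raises `X` provided every component of `S` is a regular curve, i.e. `ℓ = 0`»;
# component part `…SurfaceBadnessCureLists`; crux chain w42 `SigmaMaxModifications` stmt-ResolutionOfSingularities-18506 / conjunct `SigmaMaxModificationsCorridor3`
# stmt-ResolutionOfSingularities-19249; helper of res-L1-w42-stub-1 (gen 6), `--supports stmt-…-19249 --as helper`, counted 0)

HONEST FRAMING. OURS bookkeeping over Literature `isSNCIdeal_iff_exists_isRsopPart`, `primeOfSpecializes_mem_minimalPrimes_of_mem_maxPoints`,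
`IsRsopPart.mem_minimalPrimes_span_prod_iff`, `specializes_of_primeOfSpecializes_le` (`…SncStrata`, Stacks 01J7 / 0BI9), Mathlib `ringKrullDim_stalk_eq_coheight`
(Stacks 02IZ), and this seat's `…SurfaceBadnessCure` / `…CureLists`. The run-level transport (`(E.next C).restrictOff ι′` ≅ `cureAlong` under coincidence) is NOT
in this file. NOTHING here is a statement of H. Hironaka's manuscript [Hironaka2017] nor of [CossartJannsenSaito2020]; no named fact. AI-written; AI review is weaker
than expert review.

THE ARGUMENT. At a point `x` of codimension `≤ 2` where `S` is snc, `𝓘(S)_x = (∏_{i<r} z_i)` with `z` part of a regular system of parameters, so `r ≤ dim 𝒪_x ≤ 2`,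
and the codimension-one points of `S` through `x` inject into `Fin r` (their primes are the minimal primes `(z_i)`): AT MOST TWO of them. A crossing of a cured
member `(Γ : 𝓟_ζ)` at `x` is a pair of distinct codimension-one points of `supp (Γ : 𝓟_ζ) ⊆ supp Γ` through `x`; the only way it was NOT counted before is that
`x` lay on the bad component `cl{ζ}` — but then `ζ` and the pair are three codimension-one points of `S` through `x` unless `ζ` is one of the pair, in which case
`ζ` stays on `(Γ : 𝓟_ζ)`, i.e. `ord_ζ Γ ≥ 2`, and `cl{ζ}` is still bad after the step (`Σ cureStep l ≥ 2`), so the crossing is still not counted. The new member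
`𝓟_ζ` has the single codimension-one point `ζ`: no crossings.

## Contents (namespace `…Theorems.SigmaMaxModificationsCorridor3.Sigma`)

* `card_codimOne_through_le_two_of_isSNC` (in the form `not_three_codimOne_through`): three pairwise distinct codimension-one points of an snc configuration (off the
  generic point) cannot specialise to a common point of codimension `≤ 2`.
* `divisorialPoints_cureMember_subset`, `divisorialPoints_primeDivisorIdeal_subset`, `Boundary.crossingPts_cureAlong_primeDivisorIdeal` (`= ∅`),
  **`Boundary.crossingPts_cureAlong_subset`**, **`Boundary.crossingCount_cureAlong_le`**.
* **`Boundary.badness_cureAlong_lt`** — `S` snc, all points of codimension `≤ 2`, regular integral Noetherian carrier, non-zero locally principal members, `ζ` a BAD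
  codimension-one point ⇒ `(Γs.cureAlong ζ).badness < Γs.badness`.
-/

noncomputable section

set_option linter.dupNamespace false -- mandated namespace of this single-conjunct summit

open CategoryTheory AlgebraicGeometry TopologicalSpace IsLocalRing
open Summit.ResolutionOfSingularities.ResolutionOfSingularities.Theorems.CampaignW42
open Literature.AlgebraicGeometry.Resolution Literature.RingTheory.HilbertSamuel

namespace Summit.ResolutionOfSingularities.ResolutionOfSingularities.Theorems.SigmaMaxModificationsCorridor3.Sigma

universe u

open Scheme.IdealSheafData

/-! ## At most two codimension-one points of an snc configuration through a point of a surface -/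

section TwoBranches

variable {D : Scheme.{u}}

/-- A codimension-one point of a closed set missing the generic point of an irreducible scheme is a MAXIMAL point of the set (a proper generisation would have
codimension zero). [folklore] -/
theorem mem_maxPoints_of_coheight_eq_one [IrreducibleSpace D] {S : Set D} (hgen : genericPoint D ∉ S) {η : D} (hη : η ∈ S) (h1 : Order.coheight η = 1) :
    η ∈ maxPoints S := by
  refine ⟨hη, fun η' hη' hs => ?_⟩
  by_contra hne
  have hlt : η < η' := lt_of_le_not_ge (Scheme.le_iff_specializes.mpr hs) fun h' => hne ((hs.antisymm (Scheme.le_iff_specializes.mp h')).eq)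
  have h2 := Order.coheight_add_one_le hlt
  rw [h1] at h2
  -- `coheight η' + 1 ≤ 1` forces `coheight η' = 0`, i.e. `η'` is the generic point
  have h0 : Order.coheight η' = 0 := by
    rcases ENat.ne_top_iff_exists.mp (show Order.coheight η' ≠ ⊤ from fun e => by simp [e] at h2) with ⟨c, hc⟩
    rw [← hc] at h2 ⊢
    have : c + 1 ≤ 1 := by exact_mod_cast h2
    have hc0 : c = 0 := by omega
    simp [hc0]
  exact hgen (eq_genericPoint_of_coheight_eq_zero h0 ▸ hη')

/-- **AT MOST TWO CODIMENSION-ONE POINTS OF AN SNC CONFIGURATION PASS THROUGH A POINT OF CODIMENSION `≤ 2`**: if `S` (closed, missing the generic point) is a strict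
normal crossings divisor at `x`, `coheight x ≤ 2`, and `η₁, η₂, η₃ ∈ S` are codimension-one points specialising to `x`, then two of them coincide. [folklore] -/
theorem not_three_codimOne_through [IrreducibleSpace D] {S : Set D} (hSc : IsClosed S) (hgen : genericPoint D ∉ S) {x : D}
    (hS : IsStrictNormalCrossingsAt D S x) (h2 : Order.coheight x ≤ 2) {η : Fin 3 → D} (hη : ∀ k, η k ∈ S) (h1 : ∀ k, Order.coheight (η k) = 1)
    (hs : ∀ k, η k ⤳ x) : ¬ Function.Injective η := by
  intro hinj
  obtain ⟨r, z, -, hz, hI⟩ := (isSNCIdeal_iff_exists_isRsopPart _).mp hS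
  have hcl : (⟨closure S, isClosed_closure⟩ : Closeds D) = ⟨S, hSc⟩ := Closeds.ext hSc.closure_eq
  rw [hcl] at hI
  -- each `η k` is labelled by the index of its prime
  have key : ∀ k, ∃ i : Fin r, primeOfSpecializes (hs k) = Ideal.span {z i} := by
    intro k
    have hmin := primeOfSpecializes_mem_minimalPrimes_of_mem_maxPoints (Z := ⟨S, hSc⟩) (mem_maxPoints_of_coheight_eq_one hgen (hη k) (h1 k)) (hs k)
    rw [hI, hz.mem_minimalPrimes_span_prod_iff] at hmin
    exact hmin
  choose lab hlab using key
  -- the labelling is injective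
  have hlinj : Function.Injective lab := by
    intro k k' hkk'
    apply hinj
    have hle : primeOfSpecializes (hs k) ≤ primeOfSpecializes (hs k') := by rw [hlab k, hlab k', hkk']
    have hge : primeOfSpecializes (hs k') ≤ primeOfSpecializes (hs k) := by rw [hlab k, hlab k', hkk']
    exact ((specializes_of_primeOfSpecializes_le (hs k') (hs k) hle).antisymm (specializes_of_primeOfSpecializes_le (hs k) (hs k') hge)).eq
  -- but `r ≤ dim 𝒪_x = coheight x ≤ 2`
  have hr : r ≤ 2 := by
    obtain ⟨-, e, y, hdim, -⟩ := hz
    have h := ringKrullDim_stalk_eq_coheight x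
    rw [hdim] at h
    have h' : ((r + e : ℕ) : ℕ∞) = Order.coheight x := by exact_mod_cast h
    have : ((r + e : ℕ) : ℕ∞) ≤ 2 := h' ▸ h2
    have : r + e ≤ 2 := by exact_mod_cast this
    omega
  have := Fintype.card_le_of_injective lab hlinj
  simp only [Fintype.card_fin] at this
  omega

end TwoBranches

/-! ## Crossings of the cured list -/

section Crossings

variable {D : Scheme.{u}} [IsIntegral D] [IsNoetherian D]

omit [AlgebraicGeometry.IsIntegral D] [AlgebraicGeometry.IsNoetherian D] in
/-- The cured member has fewer divisorial points. [folklore] -/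
theorem divisorialPoints_cureMember_subset (ζ : D) (Γ : D.IdealSheafData) : divisorialPoints (cureMember ζ Γ) ⊆ divisorialPoints Γ :=
  fun _ h => ⟨support_cureMember_subset ζ Γ h.1, h.2⟩

omit [AlgebraicGeometry.IsIntegral D] [AlgebraicGeometry.IsNoetherian D] in
/-- `𝓟_ζ` has the single divisorial point `ζ`. [folklore] -/
theorem divisorialPoints_primeDivisorIdeal_subset {ζ : D} (hζ : Order.coheight ζ = 1) : divisorialPoints (primeDivisorIdeal ζ) ⊆ {ζ} := by
  intro ζ' h
  have hs : ζ ⤳ ζ' := (mem_support_primeDivisorIdeal_iff ζ ζ').mp h.1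
  by_contra hne
  exact not_specializes_of_coheight_eq_one hζ h.2 (fun e => hne (e ▸ rfl)) hs

omit [AlgebraicGeometry.IsIntegral D] [AlgebraicGeometry.IsNoetherian D] in
/-- **THE NEW MEMBER HAS NO CROSSINGS.** [folklore] -/
theorem Boundary.crossingPts_primeDivisorIdeal_eq_empty (Γs : Boundary D) {ζ : D} (hζ : Order.coheight ζ = 1) : Γs.crossingPts (primeDivisorIdeal ζ) = ∅ := by
  ext x
  simp only [Set.mem_empty_iff_false, iff_false]
  rintro ⟨⟨ζ₁, h₁, ζ₂, h₂, hne, -, -⟩, -⟩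
  have e₁ := divisorialPoints_primeDivisorIdeal_subset hζ h₁
  have e₂ := divisorialPoints_primeDivisorIdeal_subset hζ h₂
  rw [Set.mem_singleton_iff] at e₁ e₂
  exact hne (e₁.trans e₂.symm)

/-- **A CURED MEMBER HAS NO NEW COUNTED CROSSINGS** on an snc configuration of a surface (the argument in the module docstring). [folklore] -/
theorem Boundary.crossingPts_cureAlong_subset (hreg : Scheme.IsRegular D) {Γs : Boundary D} (hne : ∀ Γ ∈ Γs, Γ ≠ ⊥)
    (hS : IsStrictNormalCrossingsDivisor D Γs.divisorSet) (h2 : ∀ x : D, Order.coheight x ≤ 2) {ζ : D} (hζ : ζ ∈ Γs.codimOnePoints) {Γ : D.IdealSheafData}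
    (hΓ : Γ ∈ Γs) : (Γs.cureAlong ζ).crossingPts (cureMember ζ Γ) ⊆ Γs.crossingPts Γ := by
  intro x hx
  obtain ⟨⟨ζ₁, h₁, ζ₂, h₂, hne12, hs₁, hs₂⟩, hfilt⟩ := hx
  have h₁' := divisorialPoints_cureMember_subset ζ Γ h₁
  have h₂' := divisorialPoints_cureMember_subset ζ Γ h₂
  refine ⟨⟨ζ₁, h₁', ζ₂, h₂', hne12, hs₁, hs₂⟩, fun η hη hηx => ?_⟩
  rw [← Boundary.codimOnePoints_cureAlong hreg hζ] at hη
  have hη' := hfilt η hη hηx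
  rw [Boundary.codimOnePoints_cureAlong hreg hζ] at hη
  by_cases hηζ : ζ = η
  · subst hηζ
    -- `x ∈ cl{ζ}`: the pair and `ζ` are ≤ two codimension-one points of `S` through `x`, so `ζ ∈ {ζ₁, ζ₂}` and `ζ` stays on the cured member
    intro hbad
    have hgen : genericPoint D ∉ Γs.divisorSet := fun hg => by
      obtain ⟨Γ', hΓ', hg'⟩ := Boundary.mem_divisorSet_iff.mp hg
      exact not_mem_support_genericPoint (hne Γ' hΓ') hg'
    have hxS : x ∈ Γs.divisorSet := Boundary.mem_divisorSet_iff.mpr ⟨Γ, hΓ, Γ.support.isClosed.closure_subset_iff.mpr (Set.singleton_subset_iff.mpr h₁'.1) hs₁.mem_closure⟩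
    have hmemS : ∀ ζ' ∈ divisorialPoints Γ, ζ' ∈ Γs.divisorSet := fun ζ' h => Boundary.mem_divisorSet_iff.mpr ⟨Γ, hΓ, h.1⟩
    have h3 := not_three_codimOne_through (Boundary.isClosed_divisorSet Γs) hgen (hS.isStrictNormalCrossingsAt hxS) (h2 x) (η := ![ζ, ζ₁, ζ₂])
      (by intro k; fin_cases k <;> simp [hζ.1, hmemS ζ₁ h₁', hmemS ζ₂ h₂'])
      (by intro k; fin_cases k <;> simp [hζ.2, h₁'.2, h₂'.2]) (by intro k; fin_cases k <;> simp [hηx, hs₁, hs₂])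
    -- so `ζ = ζ₁` or `ζ = ζ₂`
    have hζ12 : ζ = ζ₁ ∨ ζ = ζ₂ := by
      by_contra hno
      push Not at hno
      apply h3
      intro k k' hkk'
      fin_cases k <;> fin_cases k' <;> simp_all
    -- hence `ζ` is a divisorial point of the cured member: `ord_ζ Γ ≥ 2`, and `cl{ζ}` stays bad
    have hζmem : ζ ∈ ((cureMember ζ Γ).support : Set D) := by
      rcases hζ12 with rfl | rfl
      · exact h₁.1
      · exact h₂.1
    have hζΓ : ζ ∈ (Γ.support : Set D) := support_cureMember_subset ζ Γ hζmem
    have hord : 2 ≤ (idealOrder Γ ζ).toNat := (mem_support_cureMember_self_iff hreg hζ.2 (hne Γ hΓ) hζΓ).mp hζmem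
    apply hη'
    rw [Boundary.compMults_cureAlong_self hreg hne hζ.2, CureLaw.cureStep, List.sum_append, List.sum_singleton]
    -- the peeled entry of `Γ` is `≥ 1`
    have hm : (idealOrder Γ ζ).toNat ∈ Γs.compMults ζ := Boundary.mem_compMults_iff.mpr ⟨Γ, mem_membersThrough_iff.mpr ⟨hΓ, hζΓ⟩, rfl⟩
    have hp : (idealOrder Γ ζ).toNat - 1 ∈ CureLaw.peel (Γs.compMults ζ) := by
      simp only [CureLaw.peel, List.mem_map, List.mem_filter, decide_eq_true_eq]
      exact ⟨_, ⟨hm, hord⟩, rfl⟩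
    have h1le : 1 ≤ (CureLaw.peel (Γs.compMults ζ)).sum := le_trans (by omega) (List.single_le_sum (fun _ _ => Nat.zero_le _) _ hp)
    omega
  · rw [Boundary.compMults_cureAlong_of_ne Γs hζ.2 hη.2 hηζ] at hη'
    exact hη'

/-- **THE CROSSING COUNT DOES NOT INCREASE.** [folklore] -/
theorem Boundary.crossingCount_cureAlong_le (hreg : Scheme.IsRegular D) {Γs : Boundary D} (hne : ∀ Γ ∈ Γs, Γ ≠ ⊥)
    (hS : IsStrictNormalCrossingsDivisor D Γs.divisorSet) (h2 : ∀ x : D, Order.coheight x ≤ 2) {ζ : D} (hζ : ζ ∈ Γs.codimOnePoints) :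
    (Γs.cureAlong ζ).crossingCount ≤ Γs.crossingCount := by
  unfold Boundary.crossingCount
  rw [Boundary.cureAlong, List.map_append, List.sum_append, List.map_singleton, List.sum_singleton,
    Boundary.crossingPts_primeDivisorIdeal_eq_empty _ hζ.2, Set.ncard_empty, add_zero, ← Boundary.cureAlong, List.map_map]
  refine List.sum_le_sum fun Γ hΓ => ?_
  exact Set.ncard_le_ncard (Boundary.crossingPts_cureAlong_subset hreg hne hS h2 hζ hΓ) (Boundary.crossingPts_finite_of_coheight_le_two h2 (hne Γ hΓ))

/-- **`M` STRICTLY DROPS AT THE CURE-CURVE STEP ALONG A BAD COMPONENT OF AN SNC CONFIGURATION OF A SURFACE** (carrier side): regular integral Noetherian `D` with all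
points of codimension `≤ 2`, non-zero members, `S` snc (`ℓ = 0`), `ζ` a codimension-one point of `S` with `S_ζ ≥ 2`. [folklore] -/
theorem Boundary.badness_cureAlong_lt (hreg : Scheme.IsRegular D) {Γs : Boundary D} (hne : ∀ Γ ∈ Γs, Γ ≠ ⊥)
    (hS : IsStrictNormalCrossingsDivisor D Γs.divisorSet) (h2 : ∀ x : D, Order.coheight x ≤ 2) {ζ : D} (hζ : ζ ∈ Γs.codimOnePoints)
    (hbad : 2 ≤ (Γs.compMults ζ).sum) : (Γs.cureAlong ζ).badness < Γs.badness := by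
  unfold Boundary.badness
  exact add_lt_add_of_lt_of_le (Boundary.finsum_compBadness_cureAlong_lt hreg hne hζ hbad)
    (Nat.mul_le_mul_left 2 (Boundary.crossingCount_cureAlong_le hreg hne hS h2 hζ))

/-- … and never increases (any codimension-one point of `S`). [folklore] -/
theorem Boundary.badness_cureAlong_le (hreg : Scheme.IsRegular D) {Γs : Boundary D} (hne : ∀ Γ ∈ Γs, Γ ≠ ⊥)
    (hS : IsStrictNormalCrossingsDivisor D Γs.divisorSet) (h2 : ∀ x : D, Order.coheight x ≤ 2) {ζ : D} (hζ : ζ ∈ Γs.codimOnePoints) :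
    (Γs.cureAlong ζ).badness ≤ Γs.badness := by
  unfold Boundary.badness
  exact add_le_add (Boundary.finsum_compBadness_cureAlong_le hreg hne hζ) (Nat.mul_le_mul_left 2 (Boundary.crossingCount_cureAlong_le hreg hne hS h2 hζ))

end Crossings

end Summit.ResolutionOfSingularities.ResolutionOfSingularities.Theorems.SigmaMaxModificationsCorridor3.Sigma

end
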